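import Literature.Computability.QuantumComplexity.PolyMajority
import Literature.Computability.QuantumComplexity.PolyCopiesWindow
import Literature.Computability.Complexity.StackBricksArith
import HarnessLib

/-!
# Watrous's `BQP(a, b)` amplification with INSTANCE-DEPENDENT thresholds: the threshold read-out and `PromiseBQP` membership

Topic `Literature/Computability/QuantumComplexity`; sequel of `PolyMajority.lean` (majority read-out of the
`K(n)`-copy family `PolyCopies.family`, BBBV Thm. 4.13) and `PolyCopiesWindow.lean` (the count of
accepting copies concentrates around `K(n)·μ`, arbitrary thresholds). Watrous 2009, §IV.2 Prop. 3 (proof):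
"an algorithm that accepts if the number of acceptances of `Q` among `p(n)` independent runs exceeds
`p(n)(a(n)+b(n))/2` … decides `A` with error …". Here the threshold is allowed to depend on the INSTANCE
`x` through two polynomial-time string functions `num, den` (binary numerals `⟦num x⟧`, `⟦den x⟧`): the
read-out accepts iff `⟦num x⟧ · K(|x|) ≤ ⟦den x⟧ · (number of accepting copies)`, i.e. iff the empirical
acceptance frequency is at least `⟦num x⟧/⟦den x⟧`. This is the form needed for promise problems whose
YES/NO thresholds are part of the input (e.g. "acceptance probability `≥ j/40` vs `≤ (j−1)/40`", `j`
parsed from the instance) or depend on the input length through several parameters.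

* `PolyCopies.thrPost`, **`PolyCopies.thrF`** — the threshold read-out as a string function on `⟨x, y⟩`
  (the counted loop `majLoop ∘ majInit` of `PolyMajority.lean` collecting the `K(|x|)` answer bits, followed
  by the comparison `¬ (⟦den x⟧·cnt < ⟦num x⟧·K(|x|))` from the bricks `prodFn`, `popCountFn`, `lenBinF`,
  `ltFn`, `notFn`); `thrF_mem_FP` (for `num, den ∈ FP`) and its value `thrF_boolPair`;
* `PolyCopies.kernelProb_thrF_true_ge` / `…_false_ge` — with margin `θ`: if one copy accepts with
  probability `≥ ⟦num x⟧/⟦den x⟧ + θ` (resp. `≤ ⟦num x⟧/⟦den x⟧ − θ`), the `K(|x|)`-copy family followed by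
  `thrF` reads `1` (resp. `0`) with probability `≥ 1 − 1/(4 K(|x|) θ²)` (`kernelProb_ge_of_threshold_of_le/ge`);
* **`exists_threshold_amplified`** — for every uniform oracle-free Clifford+T family `F`, `num, den ∈ FP`,
  every polynomial `pK` and margin function `θ(n) > 0` there is a uniform oracle-free family `F'` (the
  `K(n) = pK(n)+1` copies wrapped classically with `thrF`, `CWrap.family`) accepting with probability
  `≥ 1 − 1/(4K(|x|)θ(|x|)²)` every `x` with `⟦den x⟧ > 0` that `F` accepts with probability
  `≥ ⟦num x⟧/⟦den x⟧ + θ(|x|)`, and with probability `≤ 1/(4K(|x|)θ(|x|)²)` every such `x` that `F` accepts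
  with probability `≤ ⟦num x⟧/⟦den x⟧ − θ(|x|)`;
* **`mem_PromiseBQP_of_thresholds`** — Watrous's Prop. 3 for promise problems with instance-dependent
  rational thresholds and an inverse-polynomial margin `1/(q(|x|)+1)`: such a one-shot estimator `F` puts the
  promise problem in `PromiseBQP` (`K(n) = 3(q(n)+1)²` copies, error `≤ 1/12`);
* **`mem_PromiseBQP_of_thresholds_pre`** (appended) — the same with a classical polynomial-time
  PRE-PROCESSOR `h ∈ FP` (the estimator runs on `h v`, the thresholds are read off `h v`; read-out
  `thrF ∘ mapFstFn h` inside `CWrap.family`), the form used when the instance must first be re-encoded into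
  a padded layout whose length fixes the circuit's size parameters.

Everything here is PROVED; two definitions with bodies (`thrPost`, `thrF`, string functions), no named fact.

## References

* J. Watrous, *Quantum computational complexity*, in: Encyclopedia of Complexity and Systems Science,
  Springer 2009 (arXiv:0804.3401), §IV.1 (`BQP(a,b)`), §IV.2 Prop. 3 and its proof [Watrous2009].
* C. H. Bennett, E. Bernstein, G. Brassard, U. Vazirani, *Strengths and weaknesses of quantum computing*,
  SIAM J. Comput. 26 (1997) 1510–1523, Thm. 4.13 (proof, steps 1–4) [BennettBernsteinBrassardVazirani1997].
* S. Arora, B. Barak, *Computational Complexity: A Modern Approach*, CUP 2009, §1.3 (bounded loops and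
  schoolbook arithmetic in polynomial time) [AroraBarak2009].
-/

noncomputable section

namespace Literature.Computability.QuantumComplexity

namespace PolyCopies

open _root_.Computability Polynomial Complexity Complexity.Brick Plumb HashBricks Cryptography Finset

variable (P : Params) (num den : List Bool → List Bool)

/-! ### The threshold read-out as a string function -/

/-- The final comparison of the threshold read-out on the loop's output record
`⟨x, ⟨_, ⟨acc, _⟩⟩⟩`: the bit `¬ (⟦den x⟧ · #ones(acc) < ⟦num x⟧ · K(|x|))`, i.e.
`[⟦num x⟧ · K(|x|) ≤ ⟦den x⟧ · #ones(acc)]`. [cite: Watrous2009, §IV.2 Prop. 3 (proof: compare the number of acceptances with p(n)(a+b)/2)] -/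
def thrPost : List Bool → List Bool :=
  notFn (ltFn ∘ fanoutFn (prodFn ∘ fanoutFn (den ∘ nthF 0) (popCountFn ∘ nthF 2))
    (prodFn ∘ fanoutFn (num ∘ nthF 0) (lenBinF ∘ polyFn (KPoly P) ∘ nthF 0)))

/-- **The threshold read-out** of the `K(n)`-copy family: on `⟨x, y⟩`, the bit
`[⟦num x⟧ · K(|x|) ≤ ⟦den x⟧ · #{j < K(|x|) | y[blk |x| j 0] = 1}]` ("accept if the number of acceptances
… exceeds" the threshold fraction `⟦num x⟧/⟦den x⟧` of the copies). [cite: Watrous2009, §IV.2 Prop. 3 (proof)] -/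
def thrF : List Bool → List Bool := thrPost P num den ∘ majLoop P ∘ majInit P

variable {P num den}

/-- `thrPost ∈ FP` for `num, den ∈ FP`. [cite: AroraBarak2009, §1.3 (schoolbook arithmetic is polynomial time)] -/
theorem thrPost_mem_FP (hnum : num ∈ FP) (hden : den ∈ FP) : thrPost P num den ∈ FP :=
  notFn_mem_FP (comp_mem_FP ltFn_mem_FP (fanoutFn_mem_FP
    (comp_mem_FP prodFn_mem_FP (fanoutFn_mem_FP (comp_mem_FP hden (nthF_mem_FP 0))
      (comp_mem_FP popCountFn_mem_FP (nthF_mem_FP 2))))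
    (comp_mem_FP prodFn_mem_FP (fanoutFn_mem_FP (comp_mem_FP hnum (nthF_mem_FP 0))
      (comp_mem_FP lenBinF_mem_FP (comp_mem_FP (polyFn_mem_FP _) (nthF_mem_FP 0)))))))

/-- **The threshold read-out is polynomial time** (for `num, den ∈ FP`).
[cite: BennettBernsteinBrassardVazirani1997, Thm. 4.13 (proof: steps 1 2 4 are easily computable functions)] -/
theorem thrF_mem_FP (hnum : num ∈ FP) (hden : den ∈ FP) : thrF P num den ∈ FP :=
  comp_mem_FP (thrPost_mem_FP hnum hden) (comp_mem_FP majLoop_mem_FP majInit_mem_FP)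

/-- **Semantics of the threshold read-out.** [cite: Watrous2009, §IV.2 Prop. 3 (proof)] -/
theorem thrF_boolPair (x y : List Bool) :
    thrF P num den (boolPair x y) =
      [decide (bitsToNat (num x) * K P x.length ≤ bitsToNat (den x) * accCount (P := P) x y)] := by
  have hinit : majInit P (boolPair x y) =
      boolPair x (boolPair (encodeNat (K P x.length))
        (boolPair (accAt (P := P) x.length y 0) (restAt (P := P) x.length y 0))) := by
    simp [majInit, fanoutFn_apply, accAt, restAt, ones]
  have hloop : majLoop P (majInit P (boolPair x y)) =
      boolPair x (boolPair [] (boolPair (accAt (P := P) x.length y (K P x.length))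
        (restAt (P := P) x.length y (K P x.length)))) := by
    rw [majLoop, hinit, fstF_boolPair, eval_KPoly, iterate_loopStep (majBody P) x (K P x.length) (K P x.length) _ le_rfl,
      loopModel_majBody x y (K P x.length) 0, Nat.zero_add]
  rw [thrF, Function.comp_apply, Function.comp_apply, hloop]
  have hlt : (ltFn ∘ fanoutFn (prodFn ∘ fanoutFn (den ∘ nthF 0) (popCountFn ∘ nthF 2))
      (prodFn ∘ fanoutFn (num ∘ nthF 0) (lenBinF ∘ polyFn (KPoly P) ∘ nthF 0)))
      (boolPair x (boolPair [] (boolPair (accAt (P := P) x.length y (K P x.length))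
        (restAt (P := P) x.length y (K P x.length))))) =
      [decide (bitsToNat (den x) * accCount (P := P) x y < bitsToNat (num x) * K P x.length)] := by
    simp only [Function.comp_apply, fanoutFn_apply, nthF_zero_boolPair, nthF_succ_boolPair, polyFn_apply, eval_KPoly,
      lenBinF_apply, ones, List.length_replicate, popCountFn_apply, ltFn_boolPair, prodFn_boolPair, bitsToNat_encodeNat,
      count_accAt, accCount]
    congr 1
  rw [thrPost, notFn_apply hlt]
  simp only [List.cons.injEq, and_true]
  rw [← decide_not, decide_eq_decide]
  exact not_lt

/-! ### The read-out is right with probability `≥ 1 − 1/(4 K(n) θ²)` -/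

/-- **Yes side.** If `⟦den x⟧ > 0` and one copy accepts with probability `≥ ⟦num x⟧/⟦den x⟧ + θ`, the
`K(|x|)`-copy family followed by `thrF` reads `1` with probability `≥ 1 − 1/(4 K(|x|) θ²)`.
[cite: Watrous2009, §IV.2 Prop. 3 (proof)] -/
theorem kernelProb_thrF_true_ge (x : List Bool) {θ : ℝ} (hθ : 0 < θ) (hden : 0 < bitsToNat (den x))
    (hx : (bitsToNat (num x) : ℝ) / bitsToNat (den x) + θ ≤ P.F.acceptProbOn 0 x) :
    1 - 1 / (4 * K P x.length * θ ^ 2) ≤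
      (family P).kernelProb 0 x {y | thrF P num den (boolPair x y) = [true]} := by
  classical
  refine kernelProb_ge_of_threshold_of_le (P := P) x hθ hx _ fun z hz => ?_
  rw [Set.mem_setOf_eq, thrF_boolPair, accCount_ofFn]
  simp only [List.cons.injEq, and_true, decide_eq_true_eq]
  have hd : (0 : ℝ) < bitsToNat (den x) := by exact_mod_cast hden
  have h : (bitsToNat (num x) : ℝ) * K P x.length ≤
      (bitsToNat (den x) : ℝ) * ((univ.filter fun j : Fin (K P x.length) => z (ansW x.length j) = true).card : ℝ) := by
    rw [div_mul_eq_mul_div, div_le_iff₀ hd] at hz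
    linarith
  exact_mod_cast h

/-- **No side.** If `⟦den x⟧ > 0` and one copy accepts with probability `≤ ⟦num x⟧/⟦den x⟧ − θ`, the
`K(|x|)`-copy family followed by `thrF` reads `0` with probability `≥ 1 − 1/(4 K(|x|) θ²)`.
[cite: Watrous2009, §IV.2 Prop. 3 (proof)] -/
theorem kernelProb_thrF_false_ge (x : List Bool) {θ : ℝ} (hθ : 0 < θ) (hden : 0 < bitsToNat (den x))
    (hx : P.F.acceptProbOn 0 x ≤ (bitsToNat (num x) : ℝ) / bitsToNat (den x) - θ) :
    1 - 1 / (4 * K P x.length * θ ^ 2) ≤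
      (family P).kernelProb 0 x {y | thrF P num den (boolPair x y) = [false]} := by
  classical
  refine kernelProb_ge_of_threshold_of_ge (P := P) x hθ hx _ fun z hz => ?_
  rw [Set.mem_setOf_eq, thrF_boolPair, accCount_ofFn]
  simp only [List.cons.injEq, and_true, decide_eq_false_iff_not, not_le]
  have hd : (0 : ℝ) < bitsToNat (den x) := by exact_mod_cast hden
  have h : (bitsToNat (den x) : ℝ) * ((univ.filter fun j : Fin (K P x.length) => z (ansW x.length j) = true).card : ℝ) <
      (bitsToNat (num x) : ℝ) * K P x.length := by
    rw [div_mul_eq_mul_div, lt_div_iff₀ hd] at hz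
    linarith
  exact_mod_cast h

end PolyCopies

/-! ### Amplified families and `PromiseBQP` membership -/

open _root_.Computability Complexity Cryptography in
/-- **Threshold amplification with an instance-dependent threshold** (Watrous 2009, Prop. 3, in the tree's
uniform Clifford+T model; the threshold fraction `⟦num x⟧/⟦den x⟧` is computed from the instance by
`num, den ∈ FP`): for every uniform oracle-free family `F`, every polynomial `pK` and margin function
`θ(n) > 0` there is a uniform oracle-free family `F'` — `K(n) = pK(n)+1` parallel copies of `F` followed by
the classical threshold read-out `thrF` — such that for every `x` with `⟦den x⟧ > 0`: if `F` accepts `x` with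
probability `≥ ⟦num x⟧/⟦den x⟧ + θ(|x|)` then `F'` accepts with probability `≥ 1 − 1/(4K(|x|)θ(|x|)²)`, and if
`F` accepts with probability `≤ ⟦num x⟧/⟦den x⟧ − θ(|x|)` then `F'` accepts with probability
`≤ 1/(4K(|x|)θ(|x|)²)`. [cite: Watrous2009, §IV.2 Prop. 3] -/
theorem exists_threshold_amplified {F : QCircuitFamily cliffordT} (hF : F.IsOracleFree) (hU : F.IsUniform)
    {num den : List Bool → List Bool} (hnum : num ∈ FP) (hden : den ∈ FP)
    (pK : Polynomial ℕ) {θ : ℕ → ℝ} (hθ : ∀ n, 0 < θ n) :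
    ∃ F' : QCircuitFamily cliffordT, F'.IsOracleFree ∧ F'.IsUniform ∧ ∀ x : List Bool, 0 < bitsToNat (den x) →
      ((bitsToNat (num x) : ℝ) / bitsToNat (den x) + θ x.length ≤ F.acceptProbOn 0 x →
        1 - 1 / (4 * (pK.eval x.length + 1 : ℕ) * θ x.length ^ 2) ≤ F'.acceptProbOn 0 x) ∧
      (F.acceptProbOn 0 x ≤ (bitsToNat (num x) : ℝ) / bitsToNat (den x) - θ x.length →
        F'.acceptProbOn 0 x ≤ 1 / (4 * (pK.eval x.length + 1 : ℕ) * θ x.length ^ 2)) := by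
  obtain ⟨pF, hpF⟩ := QCircuitFamily.IsUniform.isPolySize' hU
  let P₀ : PolyCopies.Params := ⟨F, pF, fun n => (hpF n).2, pK⟩
  have hRfree : (PolyCopies.family P₀).IsOracleFree := PolyCopies.family_isOracleFree P₀ hF
  have hRU : (PolyCopies.family P₀).IsUniform := PolyCopies.family_isUniform P₀ hU
  obtain ⟨P, hPh, hPg, hPF⟩ :=
    CWrap.exists_params (PolyTimeComputable.id _) (PolyCopies.thrF_mem_FP (P := P₀) hnum hden) hRU
  have hK : ∀ x : List Bool, PolyCopies.K P₀ x.length = pK.eval x.length + 1 := fun x => rfl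
  refine ⟨CWrap.family P, CWrap.family_isOracleFree P (hPF ▸ hRfree), CWrap.family_isUniform P (hPF ▸ hRU),
    fun x hdx => ⟨fun hx => ?_, fun hx => ?_⟩⟩
  · have hker := CWrap.kernelProb_family_ge P x (fun _ => {y | PolyCopies.thrF P₀ num den (boolPair x y) = [true]})
    rw [hPh, hPg, hPF] at hker
    have hsub : {z | ∃ y ∈ ({y | PolyCopies.thrF P₀ num den (boolPair x y) = [true]} : Set (List Bool)),
        PolyCopies.thrF P₀ num den (boolPair x y) <+: z} ⊆ {z | [true] <+: z} := by
      rintro z ⟨y, hy, hz⟩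
      rw [Set.mem_setOf_eq] at hy
      rw [hy] at hz
      exact hz
    rw [← kernelProb_prefix_true_eq_acceptProbOn, ← hK]
    exact ((PolyCopies.kernelProb_thrF_true_ge (P := P₀) x (hθ x.length) hdx hx).trans hker).trans
      ((CWrap.family P).kernelProb_mono 0 x hsub)
  · have hker := CWrap.kernelProb_family_ge P x (fun _ => {y | PolyCopies.thrF P₀ num den (boolPair x y) = [false]})
    rw [hPh, hPg, hPF] at hker
    have hsub : {z | ∃ y ∈ ({y | PolyCopies.thrF P₀ num den (boolPair x y) = [false]} : Set (List Bool)),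
        PolyCopies.thrF P₀ num den (boolPair x y) <+: z} ⊆ {z | [false] <+: z} := by
      rintro z ⟨y, hy, hz⟩
      rw [Set.mem_setOf_eq] at hy
      rw [hy] at hz
      exact hz
    have h1 := ((PolyCopies.kernelProb_thrF_false_ge (P := P₀) x (hθ x.length) hdx hx).trans hker).trans
      ((CWrap.family P).kernelProb_mono 0 x hsub)
    have h2 := kernelProb_add_kernelProb_le_one (CWrap.family P) 0 x disjoint_prefix_true_false
    rw [kernelProb_prefix_true_eq_acceptProbOn] at h2
    rw [← hK]
    linarith

open _root_.Computability Complexity Cryptography in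
/-- **`PromiseBQP` from a one-shot estimator with instance-dependent rational thresholds and an
inverse-polynomial margin** (Watrous 2009, Prop. 3 for promise problems): if a uniform oracle-free
Clifford+T family `F` accepts every YES instance `x` with probability `≥ ⟦num x⟧/⟦den x⟧ + 1/(q(|x|)+1)` and
every NO instance with probability `≤ ⟦num x⟧/⟦den x⟧ − 1/(q(|x|)+1)`, where `num, den ∈ FP`, `⟦den x⟧ > 0`
on the promise and `q` is a polynomial, then the promise problem is in `PromiseBQP` (`3(q(n)+1)²` copies
bring the error to `≤ 1/12`). [cite: Watrous2009, §IV.2 Prop. 3] -/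
theorem mem_PromiseBQP_of_thresholds (Q : PromiseProblem) {F : QCircuitFamily cliffordT}
    (hF : F.IsOracleFree) (hU : F.IsUniform) {num den : List Bool → List Bool}
    (hnum : num ∈ FP) (hden : den ∈ FP) (q : Polynomial ℕ)
    (hdenY : ∀ x ∈ Q.yes, 0 < bitsToNat (den x)) (hdenN : ∀ x ∈ Q.no, 0 < bitsToNat (den x))
    (hyes : ∀ x ∈ Q.yes,
      (bitsToNat (num x) : ℝ) / bitsToNat (den x) + 1 / (((q.eval x.length : ℕ) : ℝ) + 1) ≤ F.acceptProbOn 0 x)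
    (hno : ∀ x ∈ Q.no,
      F.acceptProbOn 0 x ≤ (bitsToNat (num x) : ℝ) / bitsToNat (den x) - 1 / (((q.eval x.length : ℕ) : ℝ) + 1)) :
    Q ∈ PromiseBQP := by
  have hθ : ∀ n : ℕ, (0 : ℝ) < 1 / (((q.eval n : ℕ) : ℝ) + 1) := fun n => by positivity
  obtain ⟨F', hF', hU', hx⟩ :=
    exists_threshold_amplified hF hU hnum hden (3 * q ^ 2 + 6 * q + 2) hθ
  -- with `K(n) = 3 (q(n)+1)²` copies the error is `1/12`
  have hbound : ∀ n : ℕ,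
      1 / (4 * ((3 * q ^ 2 + 6 * q + 2).eval n + 1 : ℕ) * (1 / (((q.eval n : ℕ) : ℝ) + 1)) ^ 2) = (1 : ℝ) / 12 := by
    intro n
    have hK : (((3 * q ^ 2 + 6 * q + 2).eval n + 1 : ℕ) : ℝ) = 3 * (((q.eval n : ℕ) : ℝ) + 1) ^ 2 := by
      push_cast [Polynomial.eval_add, Polynomial.eval_mul, Polynomial.eval_pow, Polynomial.eval_ofNat]
      ring
    rw [hK]
    have hq1 : (0 : ℝ) < ((q.eval n : ℕ) : ℝ) + 1 := by positivity
    field_simp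
    norm_num
  refine ⟨F', hF', hU', fun x hxY => ?_, fun x hxN => ?_⟩
  · have h1 := ((hx x (hdenY x hxY)).1) (hyes x hxY)
    rw [hbound] at h1
    linarith
  · have h1 := ((hx x (hdenN x hxN)).2) (hno x hxN)
    rw [hbound] at h1
    linarith


/-! ### With classical pre-processing (appended) -/

open _root_.Computability Complexity Complexity.Brick Cryptography in
/-- **`PromiseBQP` from a one-shot estimator run on a PRE-PROCESSED input** (Watrous 2009, Prop. 3 for
promise problems, combined with classical polynomial-time pre-processing, Bernstein–Vazirani 1997 §8): let
`h ∈ FP` re-encode the instance (e.g. into a padded layout whose length determines all size parameters), let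
the uniform oracle-free family `G` accept `h v` with probability `≥ ⟦num (h v)⟧/⟦den (h v)⟧ + 1/(q(|h v|)+1)`
for YES instances `v` and `≤ ⟦num (h v)⟧/⟦den (h v)⟧ − 1/(q(|h v|)+1)` for NO instances (`num, den ∈ FP` read
the threshold off the re-encoded instance, `⟦den (h v)⟧ > 0` on the promise, `q` a polynomial). Then the
promise problem is in `PromiseBQP`: the wrapped family (`CWrap.family` with pre-processor `h`, `3(q+1)²`
parallel copies of `G`, and the threshold read-out `thrF ∘ mapFstFn h`) errs with probability `≤ 1/12`.
[cite: Watrous2009, §IV.2 Prop. 3] [cite: BernsteinVazirani1997, §8] -/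
theorem mem_PromiseBQP_of_thresholds_pre (Q : PromiseProblem) {h : List Bool → List Bool} (hh : h ∈ FP)
    {G : QCircuitFamily cliffordT} (hG : G.IsOracleFree) (hU : G.IsUniform)
    {num den : List Bool → List Bool} (hnum : num ∈ FP) (hden : den ∈ FP) (q : Polynomial ℕ)
    (hdenY : ∀ v ∈ Q.yes, 0 < bitsToNat (den (h v))) (hdenN : ∀ v ∈ Q.no, 0 < bitsToNat (den (h v)))
    (hyes : ∀ v ∈ Q.yes,
      (bitsToNat (num (h v)) : ℝ) / bitsToNat (den (h v)) + 1 / (((q.eval (h v).length : ℕ) : ℝ) + 1) ≤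
        G.acceptProbOn 0 (h v))
    (hno : ∀ v ∈ Q.no,
      G.acceptProbOn 0 (h v) ≤
        (bitsToNat (num (h v)) : ℝ) / bitsToNat (den (h v)) - 1 / (((q.eval (h v).length : ℕ) : ℝ) + 1)) :
    Q ∈ PromiseBQP := by
  obtain ⟨pF, hpF⟩ := QCircuitFamily.IsUniform.isPolySize' hU
  let P₀ : PolyCopies.Params := ⟨G, pF, fun n => (hpF n).2, 3 * q ^ 2 + 6 * q + 2⟩
  have hRfree : (PolyCopies.family P₀).IsOracleFree := PolyCopies.family_isOracleFree P₀ hG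
  have hRU : (PolyCopies.family P₀).IsUniform := PolyCopies.family_isUniform P₀ hU
  -- the read-out sees `⟨v, y⟩`; it re-derives `h v` to locate the answer wires and the threshold
  have hg : (PolyCopies.thrF P₀ num den ∘ mapFstFn h) ∈ FP :=
    comp_mem_FP (PolyCopies.thrF_mem_FP (P := P₀) hnum hden) (mapFstFn_mem_FP hh)
  obtain ⟨P, hPh, hPg, hPF⟩ := CWrap.exists_params hh hg hRU
  have hK : ∀ z : List Bool, (PolyCopies.K P₀ z.length : ℝ) = 3 * (((q.eval z.length : ℕ) : ℝ) + 1) ^ 2 := by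
    intro z
    show (((3 * q ^ 2 + 6 * q + 2).eval z.length + 1 : ℕ) : ℝ) = _
    push_cast [Polynomial.eval_add, Polynomial.eval_mul, Polynomial.eval_pow, Polynomial.eval_ofNat]
    ring
  have hθ : ∀ z : List Bool, (0 : ℝ) < 1 / (((q.eval z.length : ℕ) : ℝ) + 1) := fun z => by positivity
  -- with `K = 3(q+1)²` copies and margin `1/(q+1)` the error is `1/12`
  have hbound : ∀ z : List Bool,
      1 - 1 / (4 * (PolyCopies.K P₀ z.length : ℝ) * (1 / (((q.eval z.length : ℕ) : ℝ) + 1)) ^ 2) = (11 : ℝ) / 12 := by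
    intro z
    rw [hK z]
    have hq1 : (0 : ℝ) < ((q.eval z.length : ℕ) : ℝ) + 1 := by positivity
    field_simp
    norm_num
  have hgval : ∀ v y : List Bool,
      (PolyCopies.thrF P₀ num den ∘ mapFstFn h) (boolPair v y) = PolyCopies.thrF P₀ num den (boolPair (h v) y) := by
    intro v y
    rw [Function.comp_apply, mapFstFn_boolPair]
  refine ⟨CWrap.family P, CWrap.family_isOracleFree P (hPF ▸ hRfree), CWrap.family_isUniform P (hPF ▸ hRU),
    fun v hv => ?_, fun v hv => ?_⟩
  · have hker := CWrap.kernelProb_family_ge P v (fun z => {y | PolyCopies.thrF P₀ num den (boolPair z y) = [true]})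
    rw [hPh, hPg, hPF] at hker
    have hsub : {z' | ∃ y ∈ ({y | PolyCopies.thrF P₀ num den (boolPair (h v) y) = [true]} : Set (List Bool)),
        (PolyCopies.thrF P₀ num den ∘ mapFstFn h) (boolPair v y) <+: z'} ⊆ {z' | [true] <+: z'} := by
      rintro z' ⟨y, hy, hz⟩
      rw [Set.mem_setOf_eq] at hy
      rw [hgval, hy] at hz
      exact hz
    rw [← kernelProb_prefix_true_eq_acceptProbOn]
    have h1 := PolyCopies.kernelProb_thrF_true_ge (P := P₀) (num := num) (den := den) (h v) (hθ (h v))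
      (hdenY v hv) (hyes v hv)
    rw [hbound] at h1
    linarith [(h1.trans hker).trans ((CWrap.family P).kernelProb_mono 0 v hsub)]
  · have hker := CWrap.kernelProb_family_ge P v (fun z => {y | PolyCopies.thrF P₀ num den (boolPair z y) = [false]})
    rw [hPh, hPg, hPF] at hker
    have hsub : {z' | ∃ y ∈ ({y | PolyCopies.thrF P₀ num den (boolPair (h v) y) = [false]} : Set (List Bool)),
        (PolyCopies.thrF P₀ num den ∘ mapFstFn h) (boolPair v y) <+: z'} ⊆ {z' | [false] <+: z'} := by
      rintro z' ⟨y, hy, hz⟩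
      rw [Set.mem_setOf_eq] at hy
      rw [hgval, hy] at hz
      exact hz
    have h1 := PolyCopies.kernelProb_thrF_false_ge (P := P₀) (num := num) (den := den) (h v) (hθ (h v))
      (hdenN v hv) (hno v hv)
    rw [hbound] at h1
    have h2 := (h1.trans hker).trans ((CWrap.family P).kernelProb_mono 0 v hsub)
    have h3 := kernelProb_add_kernelProb_le_one (CWrap.family P) 0 v disjoint_prefix_true_false
    rw [kernelProb_prefix_true_eq_acceptProbOn] at h3
    linarith

end Literature.Computability.QuantumComplexity

end
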